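import Mathlib
import Summits.AtomisticToContinuum.Crystallization.Theorems.PricedLinkCensusTruncatedCensusGapBarlowWindowLink
import Summits.AtomisticToContinuum.Crystallization.Theorems.PricedLinkCensusTruncatedCensusGapChargeFreeOpenAtGerm
import Literature.MathematicalPhysics.StatisticalMechanics.MuGroundStateConfiguration

/-!
# Charge-freeness at tolerance 1/100 is open at Barlow patches (spacing window `[0.812a, 0.821a]`)

Stub `stub_chargeFreeOpenAtBarlow` of the line `sharp-m-potential-compactness` for the crux
`PricedLinkCensus.TruncatedCensusGap` (item stmt-AtomisticToContinuum-14230), registered by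
`ledger skeleton check` on `Cruxes/TruncatedCensusGap/Lines/sharp_m_potential_compactness.lean`.
The final statement is the registered signature VERBATIM (self-contained over tree declarations).

For `δ = 1/2000`, a site whose `3a`-neighbourhood is `a/2`-separated and two-way `δa`-matched
(`BallMatch`) to a rigid image of a Barlow stacking `barlowStacking a c s` (`s` Hägg, layer spacing
`0.812a ≤ c ≤ 0.821a`) is charge-free at tolerance `1/100`.

## Proof layout and margin ledger

The wide-window twin of the landed `isChargeFree_of_germMatched`
(`…ChargeFreeOpenAtGerm`, window `[0.9973a, 1.0027a]`, precision `1/1000`): here the near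
distances of the reference set lie in the WIDER window `[0.9963a, 1.0037a]` and the precision is
`1/2000`, so that all derived constants coincide with the landed ones:

* near window: `0.9963² = 0.99261369 ≤ 1/3 + 0.812² = 0.99267…` and
  `1/3 + 0.821² = 1.00737… ≤ 1.0037² = 1.00741369` (`wgerm_window_bounds`);
* matched first-shell site distances: `[0.9963 − 2δ, 1.0037 + 2δ] a = [0.9953a, 1.0047a]`;
* bond test: `1.0047 ≤ 1.01 · 0.9953 = 1.005253` (margin `5.5 · 10⁻⁴`);
* non-bonds: a bond at a shell site is `≤ 1.01 · 1.0047 a = 1.014747 a` long, its reference points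
  are `≤ 1.014747a + 2δa = 1.015747 a < 7a/5` apart, hence near points; every non-near reference
  distance is `≥ 7a/5`;
* uniqueness: `2δa = a/1000 < a/2` (sites) and `< 81a/100 ≤ min a c` (reference points), so the
  landed `germ_point_unique`, `germ_site_unique`, `germ_injOn` (precision `1/1000`) apply after
  weakening `a/2000 ≤ a/1000`.

`wgerm_*` re-prove the window-dependent part of the matching dictionary
(`wgerm_near_site`, `wgerm_le_dist`, `wgerm_le_nearestDist`, `wgerm_neighborSet_root`,
`wgerm_inter_neighborSet`), whence `isChargeFree_of_wideGermMatched`; the stub pulls the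
configuration back by the rigid motion `g` and takes `T = barlowStacking a c s`, with the window
link from the landed `stub_barlowWindowLink` (valid for `0.81a ≤ c ≤ 0.85a`).
-/

noncomputable section

namespace Summit.AtomisticToContinuum.Crystallization.Theorems.PricedLinkCensusTruncatedCensusGap

open scoped BigOperators
open Literature.MathematicalPhysics.StatisticalMechanics Literature.Geometry.DiscreteGeometry

section WideGermMatched

variable {ι X : Type*} [PseudoMetricSpace X] {y : ι → X} {i : ι} {T : Set X} {a : ℝ}
  {z₀ : X} {Z : ι → X} {J : X → ι}

-- adapted from `germ_near_site` in `PricedLinkCensusTruncatedCensusGapChargeFreeOpenAtGerm`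
/-- A near point `z` of the root point `z₀` is matched by a site `J z` within `a/2000`; that site
lies within `1.0047a` of the root site and is not the root site (wide window). [folklore] -/
theorem wgerm_near_site (ha : 0 < a)
    (hT2 : ∀ z₀ ∈ T, ∀ z ∈ T, z ≠ z₀ → dist z z₀ < 7 / 5 * a →
      9963 / 10000 * a ≤ dist z z₀ ∧ dist z z₀ ≤ 10037 / 10000 * a)
    (hJ : ∀ z ∈ T, dist z (y i) ≤ 3 * a → dist (y (J z)) z ≤ 1 / 2000 * a)
    (hz₀ : z₀ ∈ T) (hiz₀ : dist (y i) z₀ ≤ 1 / 2000 * a)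
    {z : X} (hz : z ∈ T) (hne : z ≠ z₀) (hd : dist z z₀ < 7 / 5 * a) :
    dist (y (J z)) z ≤ 1 / 2000 * a ∧ dist (y (J z)) (y i) ≤ 10047 / 10000 * a ∧ i ≠ J z := by
  obtain ⟨hlo, hhi⟩ := hT2 z₀ hz₀ z hz hne hd
  have hzi := dist_triangle_right z (y i) z₀
  have hJz := hJ z hz (by linarith)
  refine ⟨hJz, ?_, ?_⟩
  · -- `δ + 1.0037 + δ = 1.0047`
    have := dist_triangle (y (J z)) z (y i)
    linarith
  · intro heq
    rw [← heq, dist_comm] at hJz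
    have := dist_triangle_right z z₀ (y i)
    rw [dist_comm z₀ (y i)] at this
    linarith

-- adapted from `germ_le_dist` in `PricedLinkCensusTruncatedCensusGapChargeFreeOpenAtGerm`
/-- Every other site is at distance `≥ 0.9953a = (0.9963 − 2δ) a` from a site within `1.0047a` of
the root site (wide window). [folklore] -/
theorem wgerm_le_dist (ha : 0 < a)
    (hT2 : ∀ z₀ ∈ T, ∀ z ∈ T, z ≠ z₀ → dist z z₀ < 7 / 5 * a →
      9963 / 10000 * a ≤ dist z z₀ ∧ dist z z₀ ≤ 10037 / 10000 * a)
    (hsep : ∀ j k, j ≠ k → dist (y j) (y i) ≤ 3 * a → a / 2 ≤ dist (y j) (y k))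
    (hZ : ∀ j, dist (y j) (y i) ≤ 3 * a → Z j ∈ T ∧ dist (y j) (Z j) ≤ 1 / 2000 * a)
    {j k : ι} (hj : dist (y j) (y i) ≤ 10047 / 10000 * a) (hkj : k ≠ j) :
    9953 / 10000 * a ≤ dist (y j) (y k) := by
  by_cases hk : dist (y k) (y i) ≤ 3 * a
  · obtain ⟨hZk, hdk⟩ := hZ k hk
    have hj3 : dist (y j) (y i) ≤ 3 * a := by linarith
    obtain ⟨hZj, hdj⟩ := hZ j hj3
    have hsjk := hsep j k hkj.symm hj3
    have hne : Z k ≠ Z j := by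
      intro heq
      have h2 := dist_triangle_right (y j) (y k) (Z j)
      rw [heq] at hdk
      linarith
    have hlo : 9963 / 10000 * a ≤ dist (Z k) (Z j) := by
      by_cases hd : dist (Z k) (Z j) < 7 / 5 * a
      · exact (hT2 (Z j) hZj (Z k) hZk hne hd).1
      · linarith [not_lt.1 hd]
    have h4 := dist_triangle4 (Z k) (y k) (y j) (Z j)
    rw [dist_comm (Z k) (y k), dist_comm (y k) (y j)] at h4
    linarith
  · -- `3 − 1.0047 ≥ 0.9953`
    push Not at hk
    have := dist_triangle (y k) (y j) (y i)
    rw [dist_comm (y k) (y j)] at this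
    linarith

/-- Hence the nearest-neighbour distance of a site within `1.0047a` of the root site is
`≥ 0.9953a` (wide window). [folklore] -/
theorem wgerm_le_nearestDist (ha : 0 < a)
    (hT2 : ∀ z₀ ∈ T, ∀ z ∈ T, z ≠ z₀ → dist z z₀ < 7 / 5 * a →
      9963 / 10000 * a ≤ dist z z₀ ∧ dist z z₀ ≤ 10037 / 10000 * a)
    (hsep : ∀ j k, j ≠ k → dist (y j) (y i) ≤ 3 * a → a / 2 ≤ dist (y j) (y k))
    (hZ : ∀ j, dist (y j) (y i) ≤ 3 * a → Z j ∈ T ∧ dist (y j) (Z j) ≤ 1 / 2000 * a)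
    (hnt : ∀ j : ι, ∃ k, k ≠ j) {j : ι} (hj : dist (y j) (y i) ≤ 10047 / 10000 * a) :
    9953 / 10000 * a ≤ nearestDist y j :=
  le_nearestDist (hnt j) fun _ hk => wgerm_le_dist ha hT2 hsep hZ hj hk

-- adapted from `germ_neighborSet_root` in `PricedLinkCensusTruncatedCensusGapChargeFreeOpenAtGerm`
/-- **The bonds of the root site** are exactly the matched sites of the near points of the root
point (wide window; bond test `1.0047 ≤ 1.01 · 0.9953 = 1.005253`, non-bond test
`1.01 · 1.0047 + 2δ = 1.015747 < 7/5`). [folklore] -/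
theorem wgerm_neighborSet_root (ha : 0 < a)
    (hT2 : ∀ z₀ ∈ T, ∀ z ∈ T, z ≠ z₀ → dist z z₀ < 7 / 5 * a →
      9963 / 10000 * a ≤ dist z z₀ ∧ dist z z₀ ≤ 10037 / 10000 * a)
    (hsep : ∀ j k, j ≠ k → dist (y j) (y i) ≤ 3 * a → a / 2 ≤ dist (y j) (y k))
    (hZ : ∀ j, dist (y j) (y i) ≤ 3 * a → Z j ∈ T ∧ dist (y j) (Z j) ≤ 1 / 2000 * a)
    (hJ : ∀ z ∈ T, dist z (y i) ≤ 3 * a → dist (y (J z)) z ≤ 1 / 2000 * a)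
    (hz₀ : z₀ ∈ T) (hiz₀ : dist (y i) z₀ ≤ 1 / 2000 * a) (hnt : ∀ j : ι, ∃ k, k ≠ j)
    (hnni : nearestDist y i ≤ 10047 / 10000 * a) :
    (bondGraph (1 / 100 : ℝ) y).neighborSet i =
      J '' {z ∈ T | z ≠ z₀ ∧ dist z z₀ < 7 / 5 * a} := by
  ext k
  rw [mem_neighborSet_bondGraph]
  constructor
  · rintro ⟨hik, hdk⟩
    have hmin := min_le_left (nearestDist y i) (nearestDist y k)
    have hd : dist (y i) (y k) ≤ 1014747 / 1000000 * a := by nlinarith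
    have hk3 : dist (y k) (y i) ≤ 3 * a := by rw [dist_comm]; linarith
    obtain ⟨hZk, hdZk⟩ := hZ k hk3
    have hne : Z k ≠ z₀ := by
      intro heq
      have h1 := hsep k i (Ne.symm hik) hk3
      have h2 := dist_triangle_right (y k) (y i) (Z k)
      rw [heq] at h2 hdZk
      linarith
    have hkz₀ := dist_triangle4 (Z k) (y k) (y i) z₀
    rw [dist_comm (Z k) (y k), dist_comm (y k) (y i)] at hkz₀
    refine ⟨Z k, ⟨hZk, hne, by linarith⟩, ?_⟩
    have hZk3 : dist (Z k) (y i) ≤ 3 * a := by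
      have := dist_triangle_left (Z k) (y i) (y k)
      rw [dist_comm (y k) (y i)] at this
      linarith
    exact (germ_site_unique ha hsep hk3 (hdZk.trans (by linarith))
      ((hJ (Z k) hZk hZk3).trans (by linarith))).symm
  · rintro ⟨z, ⟨hz, hne, hd⟩, rfl⟩
    obtain ⟨-, hJzi, hiJ⟩ := wgerm_near_site ha hT2 hJ hz₀ hiz₀ hz hne hd
    refine ⟨hiJ, ?_⟩
    have h0 : dist (y i) (y i) ≤ 10047 / 10000 * a := by rw [dist_self]; positivity
    have h := le_min (wgerm_le_nearestDist ha hT2 hsep hZ hnt h0)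
      (wgerm_le_nearestDist ha hT2 hsep hZ hnt hJzi)
    rw [dist_comm] at hJzi
    linarith

-- adapted from `germ_inter_neighborSet` in `PricedLinkCensusTruncatedCensusGapChargeFreeOpenAtGerm`
/-- **The common bond-neighbours of a root bond** `{i, J z}` among the bonds of the root are
exactly the matched sites of the common near points of `z₀` and `z` (wide window). [folklore] -/
theorem wgerm_inter_neighborSet (ha : 0 < a)
    (hT1 : ∀ z ∈ T, ∀ w ∈ T, z ≠ w → 81 / 100 * a ≤ dist z w)
    (hT2 : ∀ z₀ ∈ T, ∀ z ∈ T, z ≠ z₀ → dist z z₀ < 7 / 5 * a →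
      9963 / 10000 * a ≤ dist z z₀ ∧ dist z z₀ ≤ 10037 / 10000 * a)
    (hsep : ∀ j k, j ≠ k → dist (y j) (y i) ≤ 3 * a → a / 2 ≤ dist (y j) (y k))
    (hZ : ∀ j, dist (y j) (y i) ≤ 3 * a → Z j ∈ T ∧ dist (y j) (Z j) ≤ 1 / 2000 * a)
    (hJ : ∀ z ∈ T, dist z (y i) ≤ 3 * a → dist (y (J z)) z ≤ 1 / 2000 * a)
    (hz₀ : z₀ ∈ T) (hiz₀ : dist (y i) z₀ ≤ 1 / 2000 * a) (hnt : ∀ j : ι, ∃ k, k ≠ j)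
    {z : X} (hz : z ∈ T) (hne : z ≠ z₀) (hd : dist z z₀ < 7 / 5 * a) :
    J '' {w ∈ T | w ≠ z₀ ∧ dist w z₀ < 7 / 5 * a} ∩ (bondGraph (1 / 100 : ℝ) y).neighborSet (J z) =
      J '' {w ∈ T | w ≠ z₀ ∧ w ≠ z ∧ dist w z₀ < 7 / 5 * a ∧ dist w z < 7 / 5 * a} := by
  obtain ⟨hJz, hJzi, hiJz⟩ := wgerm_near_site ha hT2 hJ hz₀ hiz₀ hz hne hd
  have hnn : nearestDist y (J z) ≤ 10047 / 10000 * a := (nearestDist_le_dist y hiJz).trans hJzi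
  ext k
  simp only [Set.mem_inter_iff, Set.mem_image, Set.mem_setOf_eq, mem_neighborSet_bondGraph]
  constructor
  · rintro ⟨⟨w, ⟨hw, hwne, hwd⟩, rfl⟩, hJzw, hdzw⟩
    obtain ⟨hJw, -, -⟩ := wgerm_near_site ha hT2 hJ hz₀ hiz₀ hw hwne hwd
    have hmin := min_le_left (nearestDist y (J z)) (nearestDist y (J w))
    have hdist : dist (y (J z)) (y (J w)) ≤ 1014747 / 1000000 * a := by nlinarith
    have h4 := dist_triangle4 w (y (J w)) (y (J z)) z
    rw [dist_comm w (y (J w)), dist_comm (y (J w)) (y (J z))] at h4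
    exact ⟨w, ⟨hw, hwne, fun h => hJzw (by rw [h]), hwd, by linarith⟩, rfl⟩
  · rintro ⟨w, ⟨hw, hwne, hwz, hwd, hwzd⟩, rfl⟩
    obtain ⟨hJw, hJwi, -⟩ := wgerm_near_site ha hT2 hJ hz₀ hiz₀ hw hwne hwd
    refine ⟨⟨w, ⟨hw, hwne, hwd⟩, rfl⟩, ?_, ?_⟩
    · intro heq
      rw [heq] at hJz
      exact hwz (germ_point_unique ha hT1 hw hz (hJw.trans (by linarith))
        (hJz.trans (by linarith)))
    · have hhi := (hT2 z hz w hw hwz hwzd).2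
      have h4 := dist_triangle4 (y (J z)) z w (y (J w))
      rw [dist_comm z w, dist_comm w (y (J w))] at h4
      have h := le_min (wgerm_le_nearestDist ha hT2 hsep hZ hnt hJzi)
        (wgerm_le_nearestDist ha hT2 hsep hZ hnt hJwi)
      linarith

-- adapted from `isChargeFree_of_germMatched` in
-- `PricedLinkCensusTruncatedCensusGapChargeFreeOpenAtGerm`
/-- **Charge-freeness of a germ-matched site (abstract form, wide window).** If the
`3a`-neighbourhood of the site `i` is `a/2`-separated and two-way `a/2000`-matched to a point set
`T` which is `81a/100`-separated, whose near points (`< 7a/5`) of every centre are twelve, at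
distances in `[0.9963a, 1.0037a]`, any two near points having exactly four common near points,
then `i` is charge-free at tolerance `1/100`. [folklore] -/
theorem isChargeFree_of_wideGermMatched (ha : 0 < a)
    (hT1 : ∀ z ∈ T, ∀ w ∈ T, z ≠ w → 81 / 100 * a ≤ dist z w)
    (hT2 : ∀ z₀ ∈ T, ∀ z ∈ T, z ≠ z₀ → dist z z₀ < 7 / 5 * a →
      9963 / 10000 * a ≤ dist z z₀ ∧ dist z z₀ ≤ 10037 / 10000 * a)
    (hT3 : ∀ z₀ ∈ T, {z ∈ T | z ≠ z₀ ∧ dist z z₀ < 7 / 5 * a}.ncard = 12)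
    (hT4 : ∀ z₀ ∈ T, ∀ z ∈ T, z ≠ z₀ → dist z z₀ < 7 / 5 * a →
      {w ∈ T | w ≠ z₀ ∧ w ≠ z ∧ dist w z₀ < 7 / 5 * a ∧ dist w z < 7 / 5 * a}.ncard = 4)
    (hsep : ∀ j k, j ≠ k → dist (y j) (y i) ≤ 3 * a → a / 2 ≤ dist (y j) (y k))
    (hM1 : ∀ j, dist (y j) (y i) ≤ 3 * a → ∃ z ∈ T, dist (y j) z ≤ 1 / 2000 * a)
    (hM2 : ∀ z ∈ T, dist z (y i) ≤ 3 * a → ∃ j, dist (y j) z ≤ 1 / 2000 * a) :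
    IsChargeFree (1 / 100 : ℝ) y i := by
  haveI : Nonempty X := ⟨y i⟩
  haveI : Nonempty ι := ⟨i⟩
  choose! Z hZ using hM1
  choose! J hJ using hM2
  have hJ' : ∀ z ∈ T, dist z (y i) ≤ 3 * a → dist (y (J z)) z ≤ 1 / 1000 * a :=
    fun z hz hzd => (hJ z hz hzd).trans (by linarith)
  obtain ⟨hz₀, hiz₀⟩ := hZ i (by rw [dist_self]; positivity)
  have h12 := hT3 (Z i) hz₀
  obtain ⟨z₁, hz₁, hne₁, hd₁⟩ := Set.nonempty_of_ncard_ne_zero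
    (s := {z ∈ T | z ≠ Z i ∧ dist z (Z i) < 7 / 5 * a}) (by rw [h12]; norm_num)
  obtain ⟨-, hJz₁i, hiJ₁⟩ := wgerm_near_site ha hT2 hJ hz₀ hiz₀ hz₁ hne₁ hd₁
  have hnt : ∀ j : ι, ∃ k, k ≠ j := fun j => by
    by_cases h : j = i
    · subst h
      exact ⟨J z₁, hiJ₁.symm⟩
    · exact ⟨i, Ne.symm h⟩
  have hnni : nearestDist y i ≤ 10047 / 10000 * a :=
    (nearestDist_le_dist y hiJ₁.symm).trans (by rw [dist_comm]; exact hJz₁i)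
  have hN := wgerm_neighborSet_root ha hT2 hsep hZ hJ hz₀ hiz₀ hnt hnni
  have hinj := germ_injOn ha hT1 hJ'
  have hsub : {z ∈ T | z ≠ Z i ∧ dist z (Z i) < 7 / 5 * a} ⊆ {z ∈ T | dist z (y i) ≤ 3 * a} := by
    rintro z ⟨hz, -, hd⟩
    have := dist_triangle_right z (y i) (Z i)
    exact ⟨hz, by linarith⟩
  refine ⟨?_, fun j hj => ?_⟩
  · rw [hN, (hinj.mono hsub).ncard_image, h12]
  · rw [hN] at hj
    obtain ⟨z, ⟨hz, hne, hd⟩, rfl⟩ := hj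
    rw [ringNumber_def, hN, wgerm_inter_neighborSet ha hT1 hT2 hsep hZ hJ hz₀ hiz₀ hnt hz hne hd,
      (hinj.mono ?_).ncard_image, hT4 (Z i) hz₀ z hz hne hd]
    rintro w ⟨hw, hwne, -, hwd, -⟩
    exact hsub ⟨hw, hwne, hwd⟩

end WideGermMatched

/-- **The spacing window in numbers**: `0.812a ≤ c ≤ 0.821a` pins the interlayer near distance
`√(a²/3 + c²)` in `[0.9963a, 1.0037a]` (`0.9963² = 0.99261369 ≤ 1/3 + 0.812² = 0.99267…`,
`1/3 + 0.821² = 1.00737… ≤ 1.0037² = 1.00741369`). [folklore] -/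
theorem wgerm_window_bounds {a c : ℝ} (ha : 0 < a) (hc1 : 812 / 1000 * a ≤ c)
    (hc2 : c ≤ 821 / 1000 * a) :
    9963 / 10000 * a ≤ Real.sqrt (a ^ 2 / 3 + c ^ 2) ∧
      Real.sqrt (a ^ 2 / 3 + c ^ 2) ≤ 10037 / 10000 * a := by
  have hc0 : 0 ≤ c := by linarith
  have hc2l : (812 / 1000 * a) ^ 2 ≤ c ^ 2 := pow_le_pow_left₀ (by positivity) hc1 2
  have hc2u : c ^ 2 ≤ (821 / 1000 * a) ^ 2 := pow_le_pow_left₀ hc0 hc2 2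
  constructor
  · rw [Real.le_sqrt' (by positivity)]
    nlinarith
  · rw [Real.sqrt_le_left (by positivity)]
    nlinarith

/-- **Charge-freeness is open at Barlow patches** (the open margin of the line
`sharp-m-potential-compactness`, radius `3a`, layer spacing freed to the window `[0.812a, 0.821a]`):
for `δ = 1/2000`, every site whose `3a`-neighbourhood is `a/2`-separated and two-way `δa`-matched
(`BallMatch`) to a rigid image of `barlowStacking a c s` (`s` Hägg, `0.812a ≤ c ≤ 0.821a`) has
twelve bonds with all ring numbers four in the scale-free bond graph at tolerance `1/100`.
[folklore] -/
theorem stub_chargeFreeOpenAtBarlow :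
    ∃ δ : ℝ, 0 < δ ∧ ∀ (N : ℕ) (y : Fin N → EuclideanSpace ℝ (Fin 3)) (i : Fin N),
      (∃ (a c : ℝ) (s : ℤ → ℤ) (g : EuclideanSpace ℝ (Fin 3) ≃ᵃⁱ[ℝ] EuclideanSpace ℝ (Fin 3)),
          0 < a ∧ 812 / 1000 * a ≤ c ∧ c ≤ 821 / 1000 * a ∧ IsHaggSeq s ∧
          (∀ j k : Fin N, j ≠ k → dist (y j) (y i) ≤ 3 * a → a / 2 ≤ dist (y j) (y k)) ∧
          BallMatch (δ * a) (3 * a) (y i) (Set.range y) (g '' barlowStacking a c s)) →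
      IsChargeFree (1 / 100 : ℝ) y i := by
  refine ⟨1 / 2000, by norm_num, ?_⟩
  rintro N y i ⟨a, c, s, g, ha, hc1, hc2, hs, hsep, hM1, hM2⟩
  obtain ⟨hl1, hl2⟩ := wgerm_window_bounds ha hc1 hc2
  have hW' := stub_barlowWindowLink a c s ha (by linarith) (by linarith) hs
  rw [← isChargeFree_comp_isometry_iff g.symm.isometry (1 / 100 : ℝ) y i]
  have hdyy : ∀ j k, dist ((⇑g.symm ∘ y) j) ((⇑g.symm ∘ y) k) = dist (y j) (y k) := fun j k =>
    g.symm.dist_map (y j) (y k)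
  have hdyz : ∀ j z, dist ((⇑g.symm ∘ y) j) z = dist (y j) (g z) := fun j z => by
    rw [Function.comp_apply, ← g.symm.dist_map (y j) (g z), g.symm_apply_apply]
  refine isChargeFree_of_wideGermMatched (T := barlowStacking a c s) ha ?_ ?_
    (fun z₀ hz₀ => (hW' z₀ hz₀).2.1) (fun z₀ hz₀ => (hW' z₀ hz₀).2.2) ?_ ?_ ?_
  · intro z hz w hw hne
    have h1 := le_dist_of_mem_barlowStacking a c s ha.le (by linarith) hz hw hne
    have h2 : 81 / 100 * a ≤ min a c := le_min (by linarith) (by linarith)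
    linarith
  · intro z₀ hz₀ z hz hne hd
    rcases (hW' z₀ hz₀).1 z hz hne hd with h | h <;> rw [h]
    · constructor <;> linarith
    · exact ⟨hl1, hl2⟩
  · intro j k hjk hj
    rw [hdyy] at hj ⊢
    exact hsep j k hjk hj
  · intro j hj
    rw [hdyy] at hj
    obtain ⟨_, ⟨z, hz, rfl⟩, hd⟩ := hM2 (y j) (Set.mem_range_self j) hj
    exact ⟨z, hz, by rw [hdyz]; exact hd⟩
  · intro z hz hd
    rw [dist_comm, hdyz, dist_comm] at hd
    obtain ⟨_, ⟨j, rfl⟩, hj⟩ := hM1 (g z) (Set.mem_image_of_mem g hz) hd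
    exact ⟨j, by rw [hdyz]; exact hj⟩

end Summit.AtomisticToContinuum.Crystallization.Theorems.PricedLinkCensusTruncatedCensusGap

end
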